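import Summits.CriticalPhenomena.CardyFormulaZ2.Theorems.CardyBoundaryCoulombGasRectilinearCardyLocalSide

/-!
# Stub `stub_boundaryArmTightness`, geometric input II: the wedge dichotomy at a boundary point
# (line `excursion-kernel-covariance`, crux `RectilinearCardy`, stmt-CriticalPhenomena-5660)

Standard sectors and the wedge dichotomy. In the frame `u = (z - b)(-i)^a` at a boundary point `b`
(the inverse frame map `w ↦ b + i^a w` is an isometry, `setOf_frame_inter_ball_eq_image`), the
STANDARD SECTOR of `m = 1, 2, 3` quadrants is `{re > 0, im > 0}`, `{im > 0}`,
`{im > 0} ∪ {re < 0}` respectively (swept counter-clockwise from the START RAY `[0, ∞)` to the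
END RAY `i^m [0, ∞)`; the end ray is the start ray of the frame turned by `(-i)^m`). Elementary
facts: the plane is covered by the two rays, the sector and the complementary sector of `4 - m`
quadrants (`onStart_or_inSec_or`); the sector misses both rays (`not_onStart_of_inSec`); its trace
on a ball is preconnected (`isPreconnected_inSec_inter_ball`). Consequence
(`wedge_dichotomy`, from `carrier_inter_ball_eq_or` of part I and the Jordan curve theorem): if
near `b` the frontier of a Jordan domain `D` consists of the start ray (a set `A`) and the end ray
(a set `B`), then near `b` the domain `D` IS the standard sector of `m` quadrants in the frame of
`A`, or the standard sector of `4 - m` quadrants in the frame of `B`.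
-/

noncomputable section

open Set Filter Topology MeasureTheory Metric
open Literature.Probability.RandomPlanarGeometry

namespace Summit.CriticalPhenomena.CardyFormulaZ2.Cruxes.RectilinearCardy.ExcursionKernelCovariance

open Complex in
/-- `(i · (-i))^n = 1`. [folklore] -/
theorem I_pow_mul_neg_I_pow (n : ℕ) : Complex.I ^ n * (-Complex.I) ^ n = 1 := by
  rw [← mul_pow]; simp

open Complex in
/-- `((-i) · i)^n = 1`. [folklore] -/
theorem neg_I_pow_mul_I_pow (n : ℕ) : (-Complex.I) ^ n * Complex.I ^ n = 1 := by
  rw [← mul_pow]; simp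

/-- The rotated frame at `b`: `z ↦ (z - b)(-i)^n` is inverted by `w ↦ b + i^n w`, which maps the
ball `B(0, r)` onto `B(b, r)`; so the trace on `B(b, r)` of a set described in the frame is the
image of the corresponding standard set. [folklore] -/
theorem setOf_frame_inter_ball_eq_image (P : ℂ → Prop) (b : ℂ) (n : ℕ) (r : ℝ) :
    {z | P ((z - b) * (-Complex.I) ^ n)} ∩ ball b r =
      (fun w => b + Complex.I ^ n * w) '' ({w | P w} ∩ ball 0 r) := by
  ext z
  simp only [mem_inter_iff, mem_setOf_eq, mem_ball, mem_image, dist_zero_right]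
  constructor
  · rintro ⟨hP, hd⟩
    refine ⟨(z - b) * (-Complex.I) ^ n, ⟨hP, ?_⟩, ?_⟩
    · rwa [norm_mul, norm_pow, norm_neg, Complex.norm_I, one_pow, mul_one, ← dist_eq_norm]
    · rw [mul_comm (z - b), ← mul_assoc, I_pow_mul_neg_I_pow, one_mul, add_sub_cancel]
  · rintro ⟨w, ⟨hP, hw⟩, rfl⟩
    have h : (b + Complex.I ^ n * w - b) * (-Complex.I) ^ n = w := by
      rw [add_sub_cancel_left, mul_comm (Complex.I ^ n), mul_assoc, I_pow_mul_neg_I_pow, mul_one]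
    refine ⟨by rwa [h], ?_⟩
    rw [dist_eq_norm, add_sub_cancel_left, norm_mul, norm_pow, Complex.norm_I, one_pow, one_mul]
    exact hw

/-- Coordinates after one clockwise quarter turn: `(u (-i)).re = u.im`, `(u (-i)).im = -u.re`.
[folklore] -/
theorem mul_neg_I_re_im (u : ℂ) : (u * -Complex.I).re = u.im ∧ (u * -Complex.I).im = -u.re := by
  constructor <;> simp

/-- **The plane is covered by the start ray, the standard sector of `m` quadrants, the end ray
`i^m [0, ∞)` and the complementary sector** (`m = 1, 2, 3`; the end ray and the complementary
sector are written in the frame turned by `(-i)^m`). [folklore] -/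
theorem onStart_or_inSec_or (m : ℕ) (hm : m = 1 ∨ m = 2 ∨ m = 3) (u : ℂ) :
    (u.im = 0 ∧ 0 ≤ u.re) ∨
      ((m = 1 → 0 < u.re ∧ 0 < u.im) ∧ (m = 2 → 0 < u.im) ∧ (m = 3 → 0 < u.im ∨ u.re < 0)) ∨
      ((u * (-Complex.I) ^ m).im = 0 ∧ 0 ≤ (u * (-Complex.I) ^ m).re) ∨
      ((4 - m = 1 → 0 < (u * (-Complex.I) ^ m).re ∧ 0 < (u * (-Complex.I) ^ m).im) ∧
        (4 - m = 2 → 0 < (u * (-Complex.I) ^ m).im) ∧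
        (4 - m = 3 → 0 < (u * (-Complex.I) ^ m).im ∨ (u * (-Complex.I) ^ m).re < 0)) := by
  rcases hm with rfl | rfl | rfl
  · have h1 : (u * (-Complex.I) ^ 1).re = u.im := by simp
    have h2 : (u * (-Complex.I) ^ 1).im = -u.re := by simp
    rw [h1, h2]
    rcases lt_trichotomy u.re 0 with hre | hre | hre <;>
      rcases lt_trichotomy u.im 0 with him | him | him
    all_goals (first
      | exact Or.inl ⟨by linarith, by linarith⟩
      | exact Or.inr (Or.inl ⟨fun _ => ⟨by linarith, by linarith⟩, fun h => absurd h (by norm_num),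
          fun h => absurd h (by norm_num)⟩)
      | exact Or.inr (Or.inr (Or.inl ⟨by linarith, by linarith⟩))
      | exact Or.inr (Or.inr (Or.inr ⟨fun h => absurd h (by norm_num),
          fun h => absurd h (by norm_num), fun _ => Or.inl (by linarith)⟩))
      | exact Or.inr (Or.inr (Or.inr ⟨fun h => absurd h (by norm_num),
          fun h => absurd h (by norm_num), fun _ => Or.inr (by linarith)⟩)))
  · have h1 : (u * (-Complex.I) ^ 2).re = -u.re := by simp [pow_two]
    have h2 : (u * (-Complex.I) ^ 2).im = -u.im := by simp [pow_two]
    rw [h1, h2]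
    rcases lt_trichotomy u.re 0 with hre | hre | hre <;>
      rcases lt_trichotomy u.im 0 with him | him | him
    all_goals (first
      | exact Or.inl ⟨by linarith, by linarith⟩
      | exact Or.inr (Or.inl ⟨fun h => absurd h (by norm_num), fun _ => by linarith,
          fun h => absurd h (by norm_num)⟩)
      | exact Or.inr (Or.inr (Or.inl ⟨by linarith, by linarith⟩))
      | exact Or.inr (Or.inr (Or.inr ⟨fun h => absurd h (by norm_num), fun _ => by linarith,
          fun h => absurd h (by norm_num)⟩)))
  · have h1 : (u * (-Complex.I) ^ 3).re = -u.im := by simp [pow_succ]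
    have h2 : (u * (-Complex.I) ^ 3).im = u.re := by simp [pow_succ]
    rw [h1, h2]
    rcases lt_trichotomy u.re 0 with hre | hre | hre <;>
      rcases lt_trichotomy u.im 0 with him | him | him
    all_goals (first
      | exact Or.inl ⟨by linarith, by linarith⟩
      | exact Or.inr (Or.inl ⟨fun h => absurd h (by norm_num), fun h => absurd h (by norm_num),
          fun _ => Or.inl (by linarith)⟩)
      | exact Or.inr (Or.inl ⟨fun h => absurd h (by norm_num), fun h => absurd h (by norm_num),
          fun _ => Or.inr (by linarith)⟩)
      | exact Or.inr (Or.inr (Or.inl ⟨by linarith, by linarith⟩))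
      | exact Or.inr (Or.inr (Or.inr ⟨fun _ => ⟨by linarith, by linarith⟩,
          fun h => absurd h (by norm_num), fun h => absurd h (by norm_num)⟩)))

/-- **The standard sector misses its two bounding rays.** [folklore] -/
theorem not_onStart_of_inSec (m : ℕ) (hm : m = 1 ∨ m = 2 ∨ m = 3) {u : ℂ}
    (hu : (m = 1 → 0 < u.re ∧ 0 < u.im) ∧ (m = 2 → 0 < u.im) ∧ (m = 3 → 0 < u.im ∨ u.re < 0)) :
    ¬ (u.im = 0 ∧ 0 ≤ u.re) ∧ ¬ ((u * (-Complex.I) ^ m).im = 0 ∧ 0 ≤ (u * (-Complex.I) ^ m).re) := by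
  obtain ⟨h1, h2, h3⟩ := hu
  rcases hm with rfl | rfl | rfl
  · obtain ⟨hre, him⟩ := h1 rfl
    have e1 : (u * (-Complex.I) ^ 1).re = u.im := by simp
    have e2 : (u * (-Complex.I) ^ 1).im = -u.re := by simp
    rw [e1, e2]
    exact ⟨fun h => by linarith [h.1], fun h => by linarith [h.1]⟩
  · have him := h2 rfl
    have e1 : (u * (-Complex.I) ^ 2).re = -u.re := by simp [pow_two]
    have e2 : (u * (-Complex.I) ^ 2).im = -u.im := by simp [pow_two]
    rw [e1, e2]
    exact ⟨fun h => by linarith [h.1], fun h => by linarith [h.1]⟩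
  · have h := h3 rfl
    have e1 : (u * (-Complex.I) ^ 3).re = -u.im := by simp [pow_succ]
    have e2 : (u * (-Complex.I) ^ 3).im = u.re := by simp [pow_succ]
    rw [e1, e2]
    refine ⟨fun h' => ?_, fun h' => ?_⟩
    · rcases h with h | h <;> linarith [h'.1, h'.2]
    · rcases h with h | h <;> linarith [h'.1, h'.2]

/-- **The trace of the standard sector on a ball is preconnected** (convex for `m = 1, 2`; for
`m = 3` the union of two convex pieces with a common point). [folklore] -/
theorem isPreconnected_inSec_inter_ball (m : ℕ) {r : ℝ} (hr : 0 < r) :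
    IsPreconnected ({u : ℂ | (m = 1 → 0 < u.re ∧ 0 < u.im) ∧ (m = 2 → 0 < u.im) ∧
      (m = 3 → 0 < u.im ∨ u.re < 0)} ∩ ball 0 r) := by
  by_cases h1 : m = 1
  · subst h1
    have : {u : ℂ | (1 = 1 → 0 < u.re ∧ 0 < u.im) ∧ (1 = 2 → 0 < u.im) ∧
        (1 = 3 → 0 < u.im ∨ u.re < 0)} = {u : ℂ | 0 < u.re} ∩ {u : ℂ | 0 < u.im} := by
      ext u; simp
    rw [this]
    exact ((convex_halfSpace_re_gt 0).inter (convex_halfSpace_im_gt 0) |>.inter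
      (convex_ball 0 r)).isPreconnected
  by_cases h2 : m = 2
  · subst h2
    have : {u : ℂ | (2 = 1 → 0 < u.re ∧ 0 < u.im) ∧ (2 = 2 → 0 < u.im) ∧
        (2 = 3 → 0 < u.im ∨ u.re < 0)} = {u : ℂ | 0 < u.im} := by
      ext u; simp
    rw [this]
    exact ((convex_halfSpace_im_gt 0).inter (convex_ball 0 r)).isPreconnected
  by_cases h3 : m = 3
  · subst h3
    have : {u : ℂ | (3 = 1 → 0 < u.re ∧ 0 < u.im) ∧ (3 = 2 → 0 < u.im) ∧
        (3 = 3 → 0 < u.im ∨ u.re < 0)} ∩ ball 0 r =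
        ({u : ℂ | 0 < u.im} ∩ ball 0 r) ∪ ({u : ℂ | u.re < 0} ∩ ball 0 r) := by
      ext u; simp only [mem_inter_iff, mem_setOf_eq, mem_union]; tauto
    rw [this]
    set w₀ : ℂ := ⟨-(r / 4), r / 4⟩ with hw₀
    have hw₀b : w₀ ∈ ball (0 : ℂ) r := by
      rw [mem_ball, dist_zero_right]
      refine lt_of_le_of_lt (Complex.norm_le_abs_re_add_abs_im w₀) ?_
      simp only [hw₀, abs_neg]
      rw [abs_of_pos (by positivity)]
      linarith
    refine IsPreconnected.union w₀ ⟨by simp [hw₀, hr], hw₀b⟩ ⟨by simp [hw₀, hr], hw₀b⟩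
      ((convex_halfSpace_im_gt 0).inter (convex_ball 0 r)).isPreconnected
      ((convex_halfSpace_re_lt 0).inter (convex_ball 0 r)).isPreconnected
  · have : {u : ℂ | (m = 1 → 0 < u.re ∧ 0 < u.im) ∧ (m = 2 → 0 < u.im) ∧
        (m = 3 → 0 < u.im ∨ u.re < 0)} = univ := by
      ext u; simp [h1, h2, h3]
    rw [this, univ_inter]
    exact (convex_ball 0 r).isPreconnected

/-- **The wedge dichotomy.** Let `b` be a frontier point of a Jordan domain `D` such that, within
distance `r` of `b`, the frontier consists of two sets `A`, `B` which in the frame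
`u = (z - b)(-i)^a` are the start ray `[0, ∞)` and the end ray `i^m [0, ∞)` (`m = 1, 2, 3`).
Then, within distance `r` of `b`, `D` is either the standard sector of `m` quadrants (swept
counter-clockwise from `A` to `B`) in this frame, or the standard sector of `4 - m` quadrants in
the frame `u' = (z - b)(-i)^(a+m)` (swept from `B` to `A`). [folklore] -/
theorem wedge_dichotomy (D : JordanDomain) {b : ℂ} (hb : b ∈ frontier D.carrier) {r : ℝ}
    (hr : 0 < r) {A B : Set ℂ} (hAf : A ⊆ frontier D.carrier) (hBf : B ⊆ frontier D.carrier)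
    (hfront : ∀ z ∈ frontier D.carrier, dist z b < r → z ∈ A ∨ z ∈ B) {a m : ℕ}
    (hm : m = 1 ∨ m = 2 ∨ m = 3)
    (hA : ∀ z, dist z b < r → (z ∈ A ↔ ((z - b) * (-Complex.I) ^ a).im = 0 ∧
      0 ≤ ((z - b) * (-Complex.I) ^ a).re))
    (hB : ∀ z, dist z b < r → (z ∈ B ↔ ((z - b) * (-Complex.I) ^ (a + m)).im = 0 ∧
      0 ≤ ((z - b) * (-Complex.I) ^ (a + m)).re)) :
    (∀ z, dist z b < r → (z ∈ D.carrier ↔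
        (m = 1 → 0 < ((z - b) * (-Complex.I) ^ a).re ∧ 0 < ((z - b) * (-Complex.I) ^ a).im) ∧
        (m = 2 → 0 < ((z - b) * (-Complex.I) ^ a).im) ∧
        (m = 3 → 0 < ((z - b) * (-Complex.I) ^ a).im ∨ ((z - b) * (-Complex.I) ^ a).re < 0))) ∨
    (∀ z, dist z b < r → (z ∈ D.carrier ↔
        (4 - m = 1 → 0 < ((z - b) * (-Complex.I) ^ (a + m)).re ∧
          0 < ((z - b) * (-Complex.I) ^ (a + m)).im) ∧
        (4 - m = 2 → 0 < ((z - b) * (-Complex.I) ^ (a + m)).im) ∧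
        (4 - m = 3 → 0 < ((z - b) * (-Complex.I) ^ (a + m)).im ∨
          ((z - b) * (-Complex.I) ^ (a + m)).re < 0))) := by
  -- the two candidate sectors, as predicates of `z`
  set P₁ : Set ℂ := {z | (m = 1 → 0 < ((z - b) * (-Complex.I) ^ a).re ∧
      0 < ((z - b) * (-Complex.I) ^ a).im) ∧ (m = 2 → 0 < ((z - b) * (-Complex.I) ^ a).im) ∧
      (m = 3 → 0 < ((z - b) * (-Complex.I) ^ a).im ∨ ((z - b) * (-Complex.I) ^ a).re < 0)}
    with hP₁
  set P₂ : Set ℂ := {z | (4 - m = 1 → 0 < ((z - b) * (-Complex.I) ^ (a + m)).re ∧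
      0 < ((z - b) * (-Complex.I) ^ (a + m)).im) ∧
      (4 - m = 2 → 0 < ((z - b) * (-Complex.I) ^ (a + m)).im) ∧
      (4 - m = 3 → 0 < ((z - b) * (-Complex.I) ^ (a + m)).im ∨
        ((z - b) * (-Complex.I) ^ (a + m)).re < 0)} with hP₂
  have hm' : 4 - m = 1 ∨ 4 - m = 2 ∨ 4 - m = 3 := by omega
  have hpow : ∀ z : ℂ, (z - b) * (-Complex.I) ^ (a + m) = (z - b) * (-Complex.I) ^ a * (-Complex.I) ^ m := by
    intro z; rw [pow_add, mul_assoc]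
  -- connectedness of the traces
  have h₁ : IsPreconnected (P₁ ∩ ball b r) := by
    rw [hP₁, setOf_frame_inter_ball_eq_image (fun u => (m = 1 → 0 < u.re ∧ 0 < u.im) ∧
      (m = 2 → 0 < u.im) ∧ (m = 3 → 0 < u.im ∨ u.re < 0)) b a r]
    exact (isPreconnected_inSec_inter_ball m hr).image _ (by fun_prop)
  have h₂ : IsPreconnected (P₂ ∩ ball b r) := by
    rw [hP₂, setOf_frame_inter_ball_eq_image (fun u => (4 - m = 1 → 0 < u.re ∧ 0 < u.im) ∧
      (4 - m = 2 → 0 < u.im) ∧ (4 - m = 3 → 0 < u.im ∨ u.re < 0)) b (a + m) r]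
    exact (isPreconnected_inSec_inter_ball (4 - m) hr).image _ (by fun_prop)
  -- covering
  have hcover : ball b r ⊆ P₁ ∪ P₂ ∪ frontier D.carrier := by
    intro z hz
    rw [mem_ball] at hz
    rcases onStart_or_inSec_or m hm ((z - b) * (-Complex.I) ^ a) with h | h | h | h
    · exact Or.inr (hAf ((hA z hz).2 h))
    · exact Or.inl (Or.inl h)
    · rw [← hpow] at h
      exact Or.inr (hBf ((hB z hz).2 h))
    · rw [← hpow] at h
      exact Or.inl (Or.inr h)
  -- the sectors miss the frontier
  have hP₁f : ∀ z ∈ P₁, dist z b < r → z ∉ frontier D.carrier := by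
    intro z hz hd hzf
    have hnot := not_onStart_of_inSec m hm hz
    rcases hfront z hzf hd with h | h
    · exact hnot.1 ((hA z hd).1 h)
    · have h' := (hB z hd).1 h
      rw [hpow] at h'
      exact hnot.2 h'
  have hP₂f : ∀ z ∈ P₂, dist z b < r → z ∉ frontier D.carrier := by
    intro z hz hd hzf
    have hnot := not_onStart_of_inSec (4 - m) hm' hz
    have h4 : (z - b) * (-Complex.I) ^ (a + m) * (-Complex.I) ^ (4 - m) =
        (z - b) * (-Complex.I) ^ a := by
      rw [hpow, mul_assoc, mul_assoc, ← pow_add, show m + (4 - m) = 4 by omega]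
      have : (-Complex.I) ^ 4 = 1 := by rw [neg_pow, Complex.I_pow_four]; norm_num
      rw [this, mul_one]
    rw [h4] at hnot
    rcases hfront z hzf hd with h | h
    · exact hnot.2 ((hA z hd).1 h)
    · exact hnot.1 ((hB z hd).1 h)
  rcases carrier_inter_ball_eq_or D hb h₁ h₂ hcover hP₁f hP₂f with h | h
  · left
    intro z hz
    have := Set.ext_iff.1 h z
    simp only [mem_inter_iff, mem_ball, hz, and_true] at this
    exact this
  · right
    intro z hz
    have := Set.ext_iff.1 h z
    simp only [mem_inter_iff, mem_ball, hz, and_true] at this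
    exact this

end Summit.CriticalPhenomena.CardyFormulaZ2.Cruxes.RectilinearCardy.ExcursionKernelCovariance

end
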